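import Literature.MathematicalPhysics.QuantumFieldTheory.Balaban1983to89.Node00.Record8Chart
import Summits.QuantumFields.YangMills.Theorems.BalabanLadderUVNonSUNRecLieRatio
import Summits.QuantumFields.YangMills.Theorems.BalabanLadderUVNonSUNRecEmlAverage
import Literature.MathematicalPhysics.QuantumLattice.RepLieAlgebraUnitary
import HarnessLib

/-!
# `UVNonSUNRec` — kernel property #4 of the `(G, r)` prescription: THE β-CHART for an arbitrary embedded
# compact group (`hsForm`-orthonormal linear chart `ℝ^{dim 𝔤} → 𝔤_r = repLieAlgebra r ⊂ 𝔲(r.N)`)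

Support module for the residual leg `UVOtherGroups ↦ UVNonSUNRec` of `route-QuantumFields-BalabanLadder`
(`stmt-QuantumFields-19356`; honest framing: a residual leg of a CONDITIONAL chain, not a gap ∕ Clay claim).
Bałaban's background-field expansion reads the fluctuation field in ORTHONORMAL COLOUR COMPONENTS `B = Σ_a B^a t_a`,
`Re Tr(t_aᴴ t_b) = c·δ_{ab}` ([Balaban1987RG1], before (1.20) and (1.21)₁ p. 264: `Π^{ab} = δ^{ab}Π`).  The tree's
Stage-8 record types this for `SU(N)` as `Node00.IsSuChart N ρ b c` and CHOOSES `Node00.suChartMap N`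
(`Node00.exists_isSuChart_one`) — the one row of the NODE-00 G-SLOT TABLE (planner census `OTHERGROUPS-CENSUS.md`
rev 5 §0⁗ V5) whose `SU(N)`-mathematics had no typed `(G, r)` replacement.  This module supplies it for EVERY compact
`G` and EVERY faithful unitary `r : LatticeRep G`:
* §1 `IsLieChart W ρ b c` — the four clauses of `IsSuChart` with `𝔰𝔲(N)` replaced by an arbitrary real subspace
  `W ≤ M_N(ℂ)`; `isSuChart_iff_isLieChart` (the generalisation is faithful); `IsLieChart.hsForm_basis`,
  `.apply_basis_ne_zero`, `.hsForm_apply` (ISOMETRY up to `c`: `Re Tr((ρv)ᴴ(ρw)) = c·Σ_a v_a w_a` — print's (1.21)₁),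
  `.injective`, `.ne_zero_of_ne_bot`, `.eq_zero_of_eq_bot`;
* §2 existence for every `W`: `exists_hsOrthonormal_family W` (verbatim the tree's
  `Node00.exists_hsOrthonormal_family_suAlgebra` with `𝔰𝔲(N) ↦ W`: `LinearMap.BilinForm.exists_orthogonal_basis` +
  positive-definiteness of `hsForm`) and `exists_isLieChart_one W : ∃ ρ : ℝ^{finrank W} →L[ℝ] M_N(ℂ), IsLieChart W ρ _ 1`;
* §3 the `(G, r)` chart: `lieChartDim r := finrank ℝ 𝔤_r`, `lieChartMap r` (CHOSEN, no junk branch),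
  `isLieChart_lieChartMap`, `lieChartMap_mem` ∕ `star_lieChartMap` (values in `𝔤_r ≤ 𝔲(N)`), `lieChartMap_onto`,
  `hsForm_lieChartMap(_single)` (isometry), `lieChartMap_injective`; for a compact SIMPLE Lie group
  `repLieAlgebra_ne_bot`, `lieChartDim_pos`, `lieChartMap_ne_zero` (THE ZERO CHART IS EXCLUDED — the `(G, r)` twin of
  `Node00.suChartMap_ne_zero`, from the LANDED `UVNonSUNRec.exists_lieRatio`); the Killing normalisation in chart
  coordinates `LieRatio.killingForm_eq_neg_mul_hsForm` (`κ(X,X) = −λ·Re Tr(XᴴX)`), `LieRatio.killingForm_lieChartMap_single`;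
* §4 consistency: `chart_lie_eq : (chart r).lie = repLieAlgebra r` (the exponential chart of kernel property #1
  has Lie algebra `𝔤_r`); `isLieChart_fundamental_iff : IsLieChart (repLieAlgebra (fundamentalLatticeRep N)) ρ b c ↔
  IsSuChart N ρ b c`, `lieChartDim_fundamental = N ^ 2 - 1`, `isSuChart_lieChartMap_fundamental`;
* §5 `hasLieChart_all` — hypothesis-free, over the route's binders: every compact simple `G`, every `r` admit a
  NON-ZERO `hsForm`-orthonormal chart `ℝ^d →L[ℝ] M_{r.N}(ℂ)` of `𝔤_r` with `0 < d`.
Everything is proved (no `sorry`, no new axioms); no `instance`, no notation.  Honest scope: linear algebra — the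
chart is an INPUT of the `(G, r)` background-field record (the replacement term for `Node00.suChartMap N` in
`ChartOfRecord` ∕ `Stage8Params.rechart`), not progress on Bałaban's (B) ∧ (0.1) ∧ N25.
-/

noncomputable section

open scoped Matrix
open scoped Matrix.Norms.L2Operator
-- `Literature.MathematicalPhysics.QuantumFieldTheory` is opened BY NAME ONLY: the transitively imported
-- `LatticeLangevinDynamics.hsForm (N : ℕ)` would otherwise shadow `CompactKillingForm.hsForm (n : Type)`.
open Literature.MathematicalPhysics.QuantumFieldTheory (LatticeRep suAlgebra mem_suAlgebra_iff IsCompactSimpleLieGroup)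
open Literature.MathematicalPhysics.QuantumLattice
open Literature.Algebra.Lie.CompactKillingForm (hsForm hsForm_apply hsForm_comm hsForm_apply_self_nonneg
  eq_zero_of_hsForm_apply_self_eq_zero hsFormOn hsFormOn_apply)
open Literature.MathematicalPhysics.QuantumFieldTheory.Balaban1983to89.Node00 (IsSuChart)

namespace Summit.QuantumFields.YangMills.Theorems.UVNonSUNRec
/-! ## §1 `IsLieChart W ρ b c` -/
section Generic
variable {N : ℕ}

/-- **An `hsForm`-orthogonal linear chart of a real matrix subspace `W ≤ M_N(ℂ)`** (RAW chart data, as in the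
tree's `Node00.IsSuChart`): (i) every chart value lies in `W`; (ii) every element of `W` is a chart value;
(iii) `Re Tr((ρ b_a)ᴴ(ρ b_a)) = c`; (iv) `Re Tr((ρ b_a)ᴴ(ρ b_a')) = 0` for `a ≠ a'` — print's orthonormal colour
components, for the Lie algebra `W = 𝔤_r` of an arbitrary embedded compact gauge group.
[cite: Balaban1987RG1, p.264 (before (1.20)) and (1.21) p.264] [problem-side definition] -/
def IsLieChart (W : Submodule ℝ (Matrix (Fin N) (Fin N) ℂ)) {V : Type*} [NormedAddCommGroup V] [NormedSpace ℝ V]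
    {ι : Type*} (ρ : V →L[ℝ] Matrix (Fin N) (Fin N) ℂ) (b : Module.Basis ι ℝ V) (c : ℝ) : Prop :=
  (∀ v : V, ρ v ∈ W) ∧
  (∀ X ∈ W, ∃ v : V, ρ v = X) ∧
  (∀ a : ι, hsForm (Fin N) (ρ (b a)) (ρ (b a)) = c) ∧
  (∀ a a' : ι, a ≠ a' → hsForm (Fin N) (ρ (b a)) (ρ (b a')) = 0)

/-- **The generalisation is faithful**: a chart of record of 𝔰𝔲(N) in the tree's sense IS an `IsLieChart` of
`suAlgebra N` (membership in 𝔰𝔲(N) = traceless skew-Hermitian, `mem_suAlgebra_iff`). [folklore] -/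
theorem isSuChart_iff_isLieChart [NeZero N] {V : Type*} [NormedAddCommGroup V] [NormedSpace ℝ V] {ι : Type*}
    (ρ : V →L[ℝ] Matrix (Fin N) (Fin N) ℂ) (b : Module.Basis ι ℝ V) (c : ℝ) :
    IsSuChart N ρ b c ↔ IsLieChart (suAlgebra N) ρ b c :=
  ⟨fun h => ⟨fun v => (mem_suAlgebra_iff _).2 (h.1 v),
    fun X hX => h.2.1 X ((mem_suAlgebra_iff X).1 hX).1 ((mem_suAlgebra_iff X).1 hX).2, h.2.2.1, h.2.2.2⟩,
   fun h => ⟨fun v => (mem_suAlgebra_iff _).1 (h.1 v),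
    fun X hXh hXt => h.2.1 X ((mem_suAlgebra_iff X).2 ⟨hXh, hXt⟩), h.2.2.1, h.2.2.2⟩⟩

variable {W : Submodule ℝ (Matrix (Fin N) (Fin N) ℂ)} {V : Type*} [NormedAddCommGroup V] [NormedSpace ℝ V]
  {ι : Type*} {ρ : V →L[ℝ] Matrix (Fin N) (Fin N) ℂ} {b : Module.Basis ι ℝ V} {c : ℝ}

/-- Chart values lie in `W`. [folklore] -/
theorem IsLieChart.mem (h : IsLieChart W ρ b c) (v : V) : ρ v ∈ W := h.1 v

/-- The chart is onto `W`. [folklore] -/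
theorem IsLieChart.exists_eq (h : IsLieChart W ρ b c) {X : Matrix (Fin N) (Fin N) ℂ} (hX : X ∈ W) :
    ∃ v : V, ρ v = X := h.2.1 X hX

/-- The range of the chart IS `W`. [folklore] -/
theorem IsLieChart.range_eq (h : IsLieChart W ρ b c) : Set.range ρ = (W : Set (Matrix (Fin N) (Fin N) ℂ)) :=
  Set.ext fun X => ⟨fun ⟨v, hv⟩ => hv ▸ h.1 v, fun hX => h.2.1 X hX⟩

/-- The Gram matrix of the chart basis: `Re Tr((ρ b_a)ᴴ(ρ b_a')) = c·δ_{aa'}`. [cite: Balaban1987RG1, (1.21) p.264] -/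
theorem IsLieChart.hsForm_basis [DecidableEq ι] (h : IsLieChart W ρ b c) (a a' : ι) :
    hsForm (Fin N) (ρ (b a)) (ρ (b a')) = if a = a' then c else 0 := by
  by_cases haa : a = a'
  · subst haa; rw [if_pos rfl]; exact h.2.2.1 a
  · rw [if_neg haa]; exact h.2.2.2 a a' haa

/-- At a chart with `0 < c`, every basis vector has a NON-ZERO chart value. [folklore] -/
theorem IsLieChart.apply_basis_ne_zero (h : IsLieChart W ρ b c) (hc : 0 < c) (a : ι) : ρ (b a) ≠ 0 := by
  intro h0
  have h1 := h.2.2.1 a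
  rw [h0] at h1
  simp only [hsForm_apply, Matrix.conjTranspose_zero, Matrix.zero_mul, Matrix.trace_zero, Complex.zero_re] at h1
  exact hc.ne' h1.symm

/-- **The chart is an isometry up to `c` (finite basis)**: `Re Tr((ρv)ᴴ(ρw)) = c · Σ_a v_a w_a` in `b`-coordinates —
print's `Π^{ab} = δ^{ab}Π` read on arbitrary vectors. [cite: Balaban1987RG1, (1.21) p.264] -/
theorem IsLieChart.hsForm_apply [Fintype ι] (h : IsLieChart W ρ b c) (v w : V) :
    hsForm (Fin N) (ρ v) (ρ w) = c * ∑ a, b.repr v a * b.repr w a := by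
  classical
  have hexp : ∀ u : V, ρ u = ∑ a, b.repr u a • ρ (b a) := fun u => by
    conv_lhs => rw [← b.sum_repr u]
    rw [map_sum]
    exact Finset.sum_congr rfl fun a _ => by rw [map_smul]
  rw [hexp v, hexp w, LinearMap.BilinForm.sum_left, Finset.mul_sum]
  refine Finset.sum_congr rfl fun a _ => ?_
  rw [LinearMap.BilinForm.smul_left, LinearMap.BilinForm.sum_right, Finset.sum_eq_single a]
  · rw [LinearMap.BilinForm.smul_right, h.2.2.1 a]
    ring
  · intro a' _ ha'
    rw [LinearMap.BilinForm.smul_right, h.2.2.2 a a' (Ne.symm ha'), mul_zero]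
  · intro ha
    exact absurd (Finset.mem_univ a) ha

/-- The squared Hilbert–Schmidt norm of a chart value: `Re Tr((ρv)ᴴ(ρv)) = c · Σ_a v_a²`. [cite: Balaban1987RG1, (1.21) p.264] -/
theorem IsLieChart.hsForm_apply_self [Fintype ι] (h : IsLieChart W ρ b c) (v : V) :
    hsForm (Fin N) (ρ v) (ρ v) = c * ∑ a, b.repr v a ^ 2 := by
  rw [h.hsForm_apply]
  exact congrArg _ (Finset.sum_congr rfl fun a _ => by ring)

/-- **A chart with `c ≠ 0` is injective** (finite basis): coordinates are read off by `hsForm` against the chart basis.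
[folklore] -/
theorem IsLieChart.injective [Fintype ι] (h : IsLieChart W ρ b c) (hc : c ≠ 0) : Function.Injective ρ := by
  classical
  intro v w hvw
  have hsub : ρ (v - w) = 0 := by rw [map_sub, hvw, sub_self]
  have hsq : c * ∑ a, b.repr (v - w) a ^ 2 = 0 := by
    rw [← h.hsForm_apply_self, hsub, LinearMap.map_zero₂]
  have hsum : ∑ a, b.repr (v - w) a ^ 2 = 0 := by
    rcases mul_eq_zero.1 hsq with h0 | h0
    · exact absurd h0 hc
    · exact h0
  have hall : ∀ a, b.repr (v - w) a = 0 := fun a => by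
    have := (Finset.sum_eq_zero_iff_of_nonneg fun a _ => sq_nonneg (b.repr (v - w) a)).1 hsum a (Finset.mem_univ a)
    exact pow_eq_zero_iff (two_ne_zero) |>.1 this
  have hvw0 : b.repr (v - w) = 0 := Finsupp.ext fun a => hall a
  exact sub_eq_zero.1 (b.repr.map_eq_zero_iff.1 hvw0)

/-- A chart of a NON-ZERO subspace is not the zero map (it is onto). [folklore] -/
theorem IsLieChart.ne_zero_of_ne_bot (h : IsLieChart W ρ b c) (hW : W ≠ ⊥) : ρ ≠ 0 := by
  obtain ⟨X, hXW, hX0⟩ := Submodule.exists_mem_ne_zero_of_ne_bot hW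
  obtain ⟨v, hv⟩ := h.2.1 X hXW
  intro hρ
  rw [hρ, zero_apply] at hv
  exact hX0 hv.symm

/-- A chart of the ZERO subspace is the zero map (its values lie in `⊥`). [folklore] -/
theorem IsLieChart.eq_zero_of_eq_bot (h : IsLieChart W ρ b c) (hW : W = ⊥) : ρ = 0 := by
  ext1 v
  have hv := h.1 v
  rw [hW, Submodule.mem_bot] at hv
  rw [hv, zero_apply]
end Generic

/-! ## §2 Existence for every real matrix subspace `W` -/
section Existence
variable {N : ℕ}

/-- **Every real subspace `W ≤ M_N(ℂ)` has a Hilbert–Schmidt-ORTHONORMAL real basis**, read as a family of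
`Module.finrank ℝ W` matrices: members of `W`, spanning `W`, pairwise `hsForm`-orthogonal with squared norms `1`
(an orthogonal basis for the symmetric form `hsForm` restricted to `W` — `LinearMap.BilinForm.exists_orthogonal_basis` —
rescaled by its positive-definite diagonal; verbatim the tree's `Node00.exists_hsOrthonormal_family_suAlgebra` with
`𝔰𝔲(N) ↦ W`). [cite: Hall2015, Exercise 7.3] -/
theorem exists_hsOrthonormal_family (W : Submodule ℝ (Matrix (Fin N) (Fin N) ℂ)) :
    ∃ G : Fin (Module.finrank ℝ W) → Matrix (Fin N) (Fin N) ℂ, (∀ a, G a ∈ W) ∧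
      (∀ X ∈ W, ∃ x : Fin (Module.finrank ℝ W) → ℝ, ∑ a, x a • G a = X) ∧
      (∀ a, hsForm (Fin N) (G a) (G a) = 1) ∧ (∀ a a', a ≠ a' → hsForm (Fin N) (G a) (G a') = 0) := by
  classical
  let B : LinearMap.BilinForm ℝ W := (hsForm (Fin N)).restrict W
  have hB : B.IsSymm := ⟨fun x y => by
    simp only [B, LinearMap.BilinForm.restrict_apply]
    exact hsForm_comm _ _⟩
  haveI : Invertible (2 : ℝ) := invertibleOfNonzero two_ne_zero
  obtain ⟨v, hv⟩ := LinearMap.BilinForm.exists_orthogonal_basis (LinearMap.BilinForm.isSymm_iff.mp hB)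
  -- the diagonal is positive (hsForm is positive definite; basis vectors are non-zero)
  have hq : ∀ a, 0 < hsForm (Fin N) (v a : Matrix (Fin N) (Fin N) ℂ) (v a) := fun a => by
    rcases (hsForm_apply_self_nonneg (v a : Matrix (Fin N) (Fin N) ℂ)).lt_or_eq with h | h
    · exact h
    · exact absurd ((Submodule.coe_eq_zero).mp (eq_zero_of_hsForm_apply_self_eq_zero h.symm)) (v.ne_zero a)
  let r : Fin (Module.finrank ℝ W) → ℝ := fun a => Real.sqrt (hsForm (Fin N) (v a : Matrix (Fin N) (Fin N) ℂ) (v a))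
  have hr : ∀ a, 0 < r a := fun a => Real.sqrt_pos.mpr (hq a)
  have hrr : ∀ a, r a * r a = hsForm (Fin N) (v a : Matrix (Fin N) (Fin N) ℂ) (v a) := fun a =>
    Real.mul_self_sqrt (hq a).le
  refine ⟨fun a => (r a)⁻¹ • (v a : Matrix (Fin N) (Fin N) ℂ), fun a => W.smul_mem _ (v a).2, ?_, ?_, ?_⟩
  · intro X hX
    refine ⟨fun a => v.repr ⟨X, hX⟩ a * r a, ?_⟩
    have hsum := congrArg Subtype.val (v.sum_repr ⟨X, hX⟩)
    rw [Submodule.coe_sum] at hsum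
    simp only [Submodule.coe_smul] at hsum
    refine Eq.trans (Finset.sum_congr rfl fun a _ => ?_) hsum
    show (v.repr ⟨X, hX⟩ a * r a) • ((r a)⁻¹ • (v a : Matrix (Fin N) (Fin N) ℂ)) = v.repr ⟨X, hX⟩ a • (v a : Matrix (Fin N) (Fin N) ℂ)
    rw [smul_smul, mul_assoc, mul_inv_cancel₀ (hr a).ne', mul_one]
  · intro a
    have hra : r a ≠ 0 := (hr a).ne'
    show hsForm (Fin N) ((r a)⁻¹ • (v a : Matrix (Fin N) (Fin N) ℂ)) ((r a)⁻¹ • (v a : Matrix (Fin N) (Fin N) ℂ)) = 1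
    rw [LinearMap.map_smul₂, map_smul, smul_eq_mul, smul_eq_mul, ← hrr a]
    field_simp
  · intro a a' haa
    have h0 : B (v a) (v a') = 0 := LinearMap.isOrthoᵢ_def.mp hv a a' haa
    simp only [B, LinearMap.BilinForm.restrict_apply, LinearMap.domRestrict_apply] at h0
    show hsForm (Fin N) ((r a)⁻¹ • (v a : Matrix (Fin N) (Fin N) ℂ)) ((r a')⁻¹ • (v a' : Matrix (Fin N) (Fin N) ℂ)) = 0
    rw [LinearMap.map_smul₂, map_smul, smul_eq_mul, smul_eq_mul, h0, mul_zero, mul_zero]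

/-- **An `IsLieChart` with `c = 1` EXISTS for every `W`**: `ℝ^{finrank W}` with its standard basis mapped onto an
`hsForm`-orthonormal basis of `W`. [cite: Balaban1987RG1, (1.20)–(1.21) p.264] [cite: Hall2015, Exercise 7.3] -/
theorem exists_isLieChart_one (W : Submodule ℝ (Matrix (Fin N) (Fin N) ℂ)) :
    ∃ ρ : (Fin (Module.finrank ℝ W) → ℝ) →L[ℝ] Matrix (Fin N) (Fin N) ℂ, IsLieChart W ρ (Pi.basisFun ℝ (Fin (Module.finrank ℝ W))) 1 := by
  classical
  obtain ⟨G, hmem, hspan, hone, horth⟩ := exists_hsOrthonormal_family W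
  refine ⟨LinearMap.toContinuousLinearMap (Fintype.linearCombination ℝ G), fun x => ?_, fun X hX => ?_, fun a => ?_,
    fun a a' haa => ?_⟩
  · rw [LinearMap.coe_toContinuousLinearMap', Fintype.linearCombination_apply]
    exact Submodule.sum_mem _ fun a _ => Submodule.smul_mem _ _ (hmem a)
  · obtain ⟨x, hx⟩ := hspan X hX
    exact ⟨x, by rw [LinearMap.coe_toContinuousLinearMap', Fintype.linearCombination_apply, hx]⟩
  · rw [Pi.basisFun_apply, LinearMap.coe_toContinuousLinearMap', Fintype.linearCombination_apply_single, one_smul]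
    exact hone a
  · rw [Pi.basisFun_apply, Pi.basisFun_apply, LinearMap.coe_toContinuousLinearMap', Fintype.linearCombination_apply_single,
      Fintype.linearCombination_apply_single, one_smul, one_smul]
    exact horth a a' haa
end Existence

/-! ## §3 The β-chart of an arbitrary embedded compact group `(G, r)` -/
section Rep
variable {G : Type} [Group G] [TopologicalSpace G] (r : LatticeRep G)

/-- **The chart dimension** `d(r) := dim_ℝ 𝔤_r` (`= N² − 1` for the fundamental representation of `SU(N)`,
`RepLieAlgebraUnitary.finrank_repLieAlgebra_fundamental`). [cite: BrockerTomDieck1985, I (2.18)] [problem-side definition] -/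
def lieChartDim : ℕ := Module.finrank ℝ (repLieAlgebra r)

/-- **THE β-CHART OF `(G, r)`**: `ℝ^{d(r)}` with its standard basis mapped onto an `hsForm`-orthonormal basis of
`𝔤_r = repLieAlgebra r`, CHOSEN from `exists_isLieChart_one` (no junk branch) — the `(G, r)` replacement term for
`Node00.suChartMap N`. [cite: Balaban1987RG1, (1.20)–(1.21) p.264] [problem-side definition] -/
def lieChartMap : (Fin (lieChartDim r) → ℝ) →L[ℝ] Matrix (Fin r.N) (Fin r.N) ℂ :=
  Classical.choose (exists_isLieChart_one (repLieAlgebra r))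

/-- The chosen chart IS an `IsLieChart` of `𝔤_r` with `c = 1`. [cite: Balaban1987RG1, (1.21) p.264] -/
theorem isLieChart_lieChartMap : IsLieChart (repLieAlgebra r) (lieChartMap r) (Pi.basisFun ℝ (Fin (lieChartDim r))) 1 :=
  Classical.choose_spec (exists_isLieChart_one (repLieAlgebra r))

/-- Chart values lie in `𝔤_r`. [folklore] -/
theorem lieChartMap_mem (x : Fin (lieChartDim r) → ℝ) : lieChartMap r x ∈ repLieAlgebra r :=
  (isLieChart_lieChartMap r).1 x

/-- Chart values are skew-Hermitian (`𝔤_r ≤ 𝔲(N)`, Hall Prop. 3.24). [cite: Hall2015, Proposition 3.24] -/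
theorem star_lieChartMap (x : Fin (lieChartDim r) → ℝ) : star (lieChartMap r x) = -(lieChartMap r x) :=
  skewAdjoint.mem_iff.1 (repLieAlgebra_le_skewAdjoint r (lieChartMap_mem r x))

/-- Chart values are skew-Hermitian, `ᴴ` form. [cite: Hall2015, Proposition 3.24] -/
theorem conjTranspose_lieChartMap (x : Fin (lieChartDim r) → ℝ) : (lieChartMap r x)ᴴ = -(lieChartMap r x) := by
  rw [← Matrix.star_eq_conjTranspose]
  exact star_lieChartMap r x

/-- The chart is ONTO `𝔤_r`. [folklore] -/
theorem lieChartMap_onto {X : Matrix (Fin r.N) (Fin r.N) ℂ} (hX : X ∈ repLieAlgebra r) :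
    ∃ x : Fin (lieChartDim r) → ℝ, lieChartMap r x = X :=
  (isLieChart_lieChartMap r).2.1 X hX

/-- The range of the chart is `𝔤_r`. [folklore] -/
theorem range_lieChartMap : Set.range (lieChartMap r) = (repLieAlgebra r : Set (Matrix (Fin r.N) (Fin r.N) ℂ)) :=
  (isLieChart_lieChartMap r).range_eq

/-- **Orthonormal colour components**: `Re Tr(t_aᴴ t_b) = δ_{ab}` for the chart basis `t_a = lieChartMap r e_a`.
[cite: Balaban1987RG1, (1.21) p.264] -/
theorem hsForm_lieChartMap_single (a b : Fin (lieChartDim r)) :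
    hsForm (Fin r.N) (lieChartMap r (Pi.single a 1)) (lieChartMap r (Pi.single b 1)) = if a = b then 1 else 0 := by
  have h := (isLieChart_lieChartMap r).hsForm_basis a b
  simp only [Pi.basisFun_apply] at h
  simpa using h

/-- **The chart is an isometry** `(ℝ^{d(r)}, euclidean) → (𝔤_r, Re Tr(XᴴY))`: `Re Tr((ρx)ᴴ(ρy)) = Σ_a x_a y_a`.
[cite: Balaban1987RG1, (1.21) p.264] -/
theorem hsForm_lieChartMap (x y : Fin (lieChartDim r) → ℝ) :
    hsForm (Fin r.N) (lieChartMap r x) (lieChartMap r y) = ∑ a, x a * y a := by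
  have h := (isLieChart_lieChartMap r).hsForm_apply x y
  simp only [Pi.basisFun_repr, one_mul] at h
  exact h

/-- The chart is injective. [folklore] -/
theorem lieChartMap_injective : Function.Injective (lieChartMap r) :=
  (isLieChart_lieChartMap r).injective one_ne_zero

variable [CompactSpace G]

section Simple
variable [IsTopologicalGroup G]

/-- **`𝔤_r ≠ 0` for a compact simple Lie group** (the LANDED `UVNonSUNRec.exists_lieRatio` supplies
`X ∈ 𝔤_r` with `Re Tr(X²) ≠ 0`). [cite: Sepanski2007, Theorem 5.18] -/
theorem repLieAlgebra_ne_bot (hG : IsCompactSimpleLieGroup G) : repLieAlgebra r ≠ ⊥ := by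
  obtain ⟨lam, hlam⟩ := exists_lieRatio hG r
  obtain ⟨X, hX⟩ := hlam.2.1
  rw [Submodule.ne_bot_iff]
  refine ⟨(X : Matrix (Fin r.N) (Fin r.N) ℂ), X.2, fun h0 => hX ?_⟩
  rw [h0, Matrix.zero_mul, Matrix.trace_zero, Complex.zero_re]

/-- **`d(r) > 0`** for a compact simple Lie group. [cite: Sepanski2007, Theorem 5.18] -/
theorem lieChartDim_pos (hG : IsCompactSimpleLieGroup G) : 0 < lieChartDim r :=
  Nat.pos_of_ne_zero fun h0 => repLieAlgebra_ne_bot r hG (Submodule.finrank_eq_zero.mp h0)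

/-- **THE ZERO CHART IS EXCLUDED** for a compact simple Lie group — the `(G, r)` twin of `Node00.suChartMap_ne_zero`
(`2 ≤ N`). [cite: Balaban1987RG1, (1.21) p.264] -/
theorem lieChartMap_ne_zero (hG : IsCompactSimpleLieGroup G) : lieChartMap r ≠ 0 :=
  (isLieChart_lieChartMap r).ne_zero_of_ne_bot (repLieAlgebra_ne_bot r hG)

/-- The index type of the chart basis is nonempty for a compact simple Lie group. [folklore] -/
theorem nonempty_fin_lieChartDim (hG : IsCompactSimpleLieGroup G) : Nonempty (Fin (lieChartDim r)) :=
  ⟨⟨0, lieChartDim_pos r hG⟩⟩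
end Simple

/-- **Killing normalisation in Hilbert–Schmidt terms**: under `LieRatio r λ`, `κ(X, X) = −λ · Re Tr(XᴴX)` on `𝔤_r`
(`Re Tr(X²) = −Re Tr(XᴴX)` for skew-Hermitian `X`). [cite: Hall2015, Exercise 7.3] -/
theorem LieRatio.killingForm_eq_neg_mul_hsForm {lam : ℝ} (h : LieRatio r lam) (X : repLieSubalgebra r) :
    killingForm ℝ (repLieSubalgebra r) X X = -lam * hsForm (Fin r.N) (X : Matrix (Fin r.N) (Fin r.N) ℂ) X := by
  rw [h.2.2 X, re_trace_mul_self_eq_neg_hsFormOn, hsFormOn_apply, hsForm_apply]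
  ring

/-- **`κ(t_a, t_a) = −λ` on the chart basis** `t_a = lieChartMap r e_a` (unit Hilbert–Schmidt norm): the quadratic
Casimir enters Bałaban's β-function as the one scalar `λ = C_A/T_r` in orthonormal colour components.
[cite: Balaban1987RG1, (1.21) p.264] -/
theorem LieRatio.killingForm_lieChartMap_single {lam : ℝ} (h : LieRatio r lam) (a : Fin (lieChartDim r)) :
    killingForm ℝ (repLieSubalgebra r) ⟨lieChartMap r (Pi.single a 1), lieChartMap_mem r _⟩
      ⟨lieChartMap r (Pi.single a 1), lieChartMap_mem r _⟩ = -lam := by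
  rw [LieRatio.killingForm_eq_neg_mul_hsForm r h, hsForm_lieChartMap_single, if_pos rfl, mul_one]

/-! ## §4 Consistency: the exponential chart's Lie algebra; the fundamental representation of `SU(N)` -/
/-- **The Lie algebra of the exponential chart of kernel property #1 IS `𝔤_r`**: membership in `(chart r).lie`
(`∀ t, exp(tX) ∈ r(G)`, Hall Cor. 3.44) is membership in `repLieAlgebra r` (closed-subgroup theorem, Hall Thm. 3.20).
[cite: Hall2015, Theorem 3.20 and Corollary 3.44] -/
theorem mem_chart_lie_iff {X : Matrix (Fin r.N) (Fin r.N) ℂ} : X ∈ (chart r).lie ↔ X ∈ repLieAlgebra r := by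
  rw [mem_repLieAlgebra_iff]
  show (∀ t : ℝ, NormedSpace.exp (t • X) ∈ Set.range r.ρ) ↔ ∀ t : ℝ, NormedSpace.exp ((t : ℂ) • X) ∈ Set.range r.ρ
  exact forall_congr' fun t => by rw [Complex.coe_smul]

/-- `(chart r).lie = repLieAlgebra r`. [cite: Hall2015, Theorem 3.20 and Corollary 3.44] -/
theorem chart_lie_eq : (chart r).lie = repLieAlgebra r :=
  Submodule.ext fun _ => mem_chart_lie_iff r

/-- Chart values exponentiate into `r(G)`: `exp (lieChartMap r x) ∈ range r.ρ`. [cite: Hall2015, Theorem 3.20] -/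
theorem exp_lieChartMap_mem (x : Fin (lieChartDim r) → ℝ) : NormedSpace.exp (lieChartMap r x) ∈ Set.range r.ρ := by
  have h := (mem_repLieAlgebra_iff r).1 (lieChartMap_mem r x) 1
  simpa using h
end Rep

section Fundamental
variable {N : ℕ} [NeZero N]

/-- **For the fundamental representation of `SU(N)` the `(G, r)` chart predicate IS the tree's chart of record predicate**:
`𝔤_{fund} = 𝔰𝔲(N)` (`RepLieAlgebraUnitary.repLieAlgebra_fundamental`). [cite: Hall2015, Proposition 3.24] -/
theorem isLieChart_fundamental_iff {V : Type*} [NormedAddCommGroup V] [NormedSpace ℝ V] {ι : Type*}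
    (ρ : V →L[ℝ] Matrix (Fin N) (Fin N) ℂ) (b : Module.Basis ι ℝ V) (c : ℝ) :
    IsLieChart (repLieAlgebra (fundamentalLatticeRep N)) ρ b c ↔ IsSuChart N ρ b c := by
  rw [isSuChart_iff_isLieChart]
  show IsLieChart (repLieAlgebra (fundamentalLatticeRep N)) ρ b c ↔ IsLieChart (suAlgebra N) ρ b c
  rw [repLieAlgebra_fundamental]
  exact Iff.rfl

omit [NeZero N] in
/-- The chart dimension of the fundamental representation of `SU(N)` is `N² − 1`. [cite: BrockerTomDieck1985, I (2.18)] -/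
theorem lieChartDim_fundamental : lieChartDim (fundamentalLatticeRep N) = N ^ 2 - 1 :=
  finrank_repLieAlgebra_fundamental N

/-- The `(G, r)` chart of the fundamental representation of `SU(N)` IS a chart of record in the tree's sense (`c = 1`).
[cite: Balaban1987RG1, (1.20)–(1.21) p.264] -/
theorem isSuChart_lieChartMap_fundamental :
    IsSuChart N (lieChartMap (fundamentalLatticeRep N)) (Pi.basisFun ℝ (Fin (lieChartDim (fundamentalLatticeRep N)))) 1 :=
  (isLieChart_fundamental_iff _ _ _).1 (isLieChart_lieChartMap (fundamentalLatticeRep N))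
end Fundamental

/-! ## §5 `∀`-packaged headline -/
/-- **KERNEL PROPERTY #4, packaged over the binder list of the residual `UVNonSUNRec`**: for every compact simple Lie
group `G` and every faithful unitary lattice representation `r`, an `hsForm`-orthonormal linear chart of `𝔤_r` of
POSITIVE dimension exists (values skew-Hermitian, onto, `Re Tr(t_aᴴt_b) = δ_{ab}`, non-zero).
[cite: Balaban1987RG1, (1.20)–(1.21) p.264] -/
theorem hasLieChart_all :
    ∀ (G : Type) [Group G] [TopologicalSpace G] [IsTopologicalGroup G] [CompactSpace G],
      IsCompactSimpleLieGroup G → ∀ r : LatticeRep G,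
        ∃ (d : ℕ) (ρ : (Fin d → ℝ) →L[ℝ] Matrix (Fin r.N) (Fin r.N) ℂ),
          0 < d ∧ IsLieChart (repLieAlgebra r) ρ (Pi.basisFun ℝ (Fin d)) 1 ∧ ρ ≠ 0 :=
  fun _ _ _ _ _ hG r => ⟨lieChartDim r, lieChartMap r, lieChartDim_pos r hG, isLieChart_lieChartMap r, lieChartMap_ne_zero r hG⟩
end Summit.QuantumFields.YangMills.Theorems.UVNonSUNRec

end
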